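import Mathlib
import HarnessLib
import HarnessLib.Audit
import Summits.AtomisticToContinuum.Statement
import Literature.MathematicalPhysics.QuantumManyBody.PeriodicBoseGas

/-!
Route: BECRelativeFisher

CLOSED (retired) 2026-08-15T13:40:05Z by operator:999:1257524 — reason: not-a-thesis: assembly does not conclude the sub-problem Statement — note: D-0027 §2.1 audit (human 2026-08-15: routes that do not decide the summit are removed): the assembly concludes `Literature.MathematicalPhysics.QuantumManyBody.BoseGas.BoseEinsteinCondensation`, not the sub-problem statement; a NEW conforming route may be opened from the same idea (generated `closes . The file is kept as the record of this route; refuted decls are indexed as negative knowledge (`ledger negatives`).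

# Route BECRelativeFisher — energy excess = ¼ relative Fisher information — transfer coherence from
a positive trial state to the ground state up to the healing scale, then propagate it

It suffices to show X = X_loc ∧ X_prop on the thermodynamic TORUS of side L = (N/ρ)^{1/3} (card
relative-fisher-landscape-transfer). Write G_Ψ(i,r) := Re ∫_{cell^N} conj Ψ(X with X_i ↦ X_i + r) ·
Ψ(X) dX for the one-particle
displacement coherence of a periodic state (the convention of route BECTorusUnfolding; n₀(Ψ)/N is
the average of G over r in the cell,
its support item CoherenceCriterion). X_loc (HealingScaleCoherence): for some σ > 0, every
δ_N-near-minimiser of the periodic energy has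
G(i,r) ≥ 3/4 for all |r| ≤ a(ρa³)^{-1/2-σ} — coherence parametrically BEYOND the healing length
(ρa)^{-1/2}, in the thermodynamic object,
from ENERGY alone through the identity ⟨Φ,(H−E₀)Φ⟩ = ∫|∇(Φ/Ψ₀)|²Ψ₀² = ¼·I(P_Φ‖P_Ψ₀) (energy excess
of a positive trial state Φ = relative
Fisher information of |Φ|² w.r.t. |Ψ₀|²) plus positivity. X_prop (CoherencePropagation): for every σ
> 0, coherence ≥ 3/4 up to
a(ρa³)^{-1/2-σ} forces constant-mode occupation ≥ cN. X gives PeriodicBEC (item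
stmt-AtomisticToContinuum-0826, shared; here the rank-0
target) and, with the shared transfer BoundaryTransferWeak (stmt-AtomisticToContinuum-0827), the
Dirichlet conjunct.
Lean: `(∀ v : ℝ → ENNReal,
Literature.MathematicalPhysics.QuantumManyBody.BoseGas.IsRepulsiveFiniteRange v → ∃ σ : ℝ, 0 < σ ∧ ∃
ρ₀ : ℝ, 0 < ρ₀ ∧ ∀ ρ : ℝ, 0 < ρ → ρ < ρ₀ → ∀ᶠ N : ℕ in Filter.atTop, ∃ δ : ENNReal, 0 < δ ∧ ∀ Ψ :
Literature.MathematicalPhysics.QuantumManyBody.BoseGas.PeriodicTrialState N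
(Literature.MathematicalPhysics.QuantumManyBody.BoseGas.sideLength ρ N),
Literature.MathematicalPhysics.QuantumManyBody.BoseGas.periodicEnergy v Ψ ≤
Literature.MathematicalPhysics.QuantumManyBody.BoseGas.periodicGroundStateEnergy v N
(Literature.MathematicalPhysics.QuantumManyBody.BoseGas.sideLength ρ N) + δ → ∀ (i : Fin N) (r :
EuclideanSpace ℝ (Fin 3)), ‖r‖ ≤
(Literature.MathematicalPhysics.QuantumManyBody.BoseGas.scatteringLength v).toReal * (ρ *
(Literature.MathematicalPhysics.QuantumManyBody.BoseGas.scatteringLength v).toReal ^ 3) ^ (-(1 : ℝ)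
/ 2 - σ) → (3 / 4 : ℝ) ≤ (∫ X in Literature.MathematicalPhysics.QuantumManyBody.BoseGas.cellN N
(Literature.MathematicalPhysics.QuantumManyBody.BoseGas.sideLength ρ N), conj (Ψ.ψ (Function.update
X i (X i + r))) * Ψ.ψ X).re) ∧ (∀ v : ℝ → ENNReal,
Literature.MathematicalPhysics.QuantumManyBody.BoseGas.IsRepulsiveFiniteRange v → ∀ σ : ℝ, 0 < σ → ∃
ρ₀ : ℝ, 0 < ρ₀ ∧ ∀ ρ : ℝ, 0 < ρ → ρ < ρ₀ → ∃ c : ℝ, 0 < c ∧ ∀ᶠ N : ℕ in Filter.atTop, ∃ δ : ENNReal,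
0 < δ ∧ ∀ Ψ : Literature.MathematicalPhysics.QuantumManyBody.BoseGas.PeriodicTrialState N
(Literature.MathematicalPhysics.QuantumManyBody.BoseGas.sideLength ρ N),
Literature.MathematicalPhysics.QuantumManyBody.BoseGas.periodicEnergy v Ψ ≤
Literature.MathematicalPhysics.QuantumManyBody.BoseGas.periodicGroundStateEnergy v N
(Literature.MathematicalPhysics.QuantumManyBody.BoseGas.sideLength ρ N) + δ → (∀ (i : Fin N) (r :
EuclideanSpace ℝ (Fin 3)), ‖r‖ ≤
(Literature.MathematicalPhysics.QuantumManyBody.BoseGas.scatteringLength v).toReal * (ρ *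
(Literature.MathematicalPhysics.QuantumManyBody.BoseGas.scatteringLength v).toReal ^ 3) ^ (-(1 : ℝ)
/ 2 - σ) → (3 / 4 : ℝ) ≤ (∫ X in Literature.MathematicalPhysics.QuantumManyBody.BoseGas.cellN N
(Literature.MathematicalPhysics.QuantumManyBody.BoseGas.sideLength ρ N), conj (Ψ.ψ (Function.update
X i (X i + r))) * Ψ.ψ X).re) → ENNReal.ofReal (c * N) ≤
Literature.MathematicalPhysics.QuantumManyBody.BoseGas.condensateOccupation N
(Literature.MathematicalPhysics.QuantumManyBody.BoseGas.sideLength ρ N) Ψ.ψ)`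

## Assembly
Pure logic (proved in the planner's Sketch.lean as assembly_provable): fix v; HealingScaleCoherence
gives σ, ρ₂;
CoherencePropagation at that σ gives ρ₁ and, for ρ < min ρ₁ ρ₂, a constant c and eventually-in-N
thresholds δ₁, δ₂; with
δ = min δ₁ δ₂ every δ-near-minimiser satisfies both, hence the PeriodicBEC clause for v;
BoundaryTransferWeak turns it into
HasGroundStateBEC v ρ for small ρ, i.e. the conjunct. PeriodicPhaseRigidity and
GroundStateRepresentation are inputs of ranks 2/4, not
antecedents of the assembly.

Rationale: WHY THIS LINE. The ground-state representation ⟨Φ,(H−E₀)Φ⟩ = ∫|∇(Φ/Ψ₀)|²Ψ₀² (LSSY2005 Ch. 2 /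
Dyson-lemma proofs; Dirichlet form of the
ground-state-transformed generator, AlbeverioHoeghkrohnStreit1977) says that the energy excess per
particle e of a POSITIVE trial
state equals ¼ of the mean-square mismatch between its conditional one-body drift and the true one
(relative Fisher information,
OttoVillani2000); since for Ψ₀ > 0 the coherence γ₀(x,y)/ρ is the Bhattacharyya affinity of the Palm
laws at x and y, a
displacement/Cauchy–Schwarz step in the trial bridge measure transfers the trial state's explicit
coherence to Ψ₀ up to |r| ≲ e^{-1/2}
— using exactly the two exits (eigenvalue equation beyond the value E₀; positivity) that the PROVED
energy-window obstruction
Literature.Barriers.AtomisticToContinuum.KineticGapLengthScalesNarrow leaves open, with no box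
hierarchy and no spectral gap. With the
tree's PROVED two-sided bounds (LSSY2005_lowerBound_periodic_holds,
LSSY2005_upperBound_periodic_holds: e ≲ ρaY^{1/17}, the upper bound
BY a positive symmetric periodic Jastrow state, LSSY2005_jastrowBound_holds) this reaches
a(ρa³)^{-1/2-σ}, σ < 1/34 (X_loc); with LHY
two-sided bounds (FournaisSolovej2020, YauYin2009, BastiCenatiempoSchlein2021, BastiEtAl2024) it
reaches Junge2026's scale a(ρa³)^{-3/4}
gap-free (support LhyScaleCoherence), and the Galilei-boost witnesses of
KineticGapLengthScalesNarrow show that energy information stops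
exactly there (the card's (B), already a theorem of the tree). Imported: relative entropy /
Fisher-information calculus of diffusion
generators (kinetic theory, OttoVillani2000) and the Palm/affinity reading of ODLRO for positive
states. What the line does that the
sibling routes do not: BECTorusUnfolding files ODLRO at FIXED range after the limit
(FixedRangeOrder) plus a monotonicity in L;
BECParentHamiltonian files the true-law Fisher information w.r.t. a Jastrow parent
(ParentEnergyProximity, no rate) and corrector
flatness; BECPalmLandscape / BECSwapAffinity / BECConditionalEntropy posit O(1) bounds on the TRUE
landscape (Dirichlet); this route
splits PeriodicBEC along the LENGTH axis into an energy-driven half stated at a ρ-dependent,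
N-uniform scale and resting on proved cone
facts (X_loc), and the genuinely infrared half (X_prop), for which it proposes the card's mismatch
programme (crux (C), filed informally:
f = Ψ₀/Φ is the principal eigenfunction of the Witten Laplacian −L_Φ + e_loc of the trial measure,
whose one-particle spectrum is the
phonon branch; IR-regularity of log f in the window |k| < e^{1/2} is all that is missing).

RANKED CRUXES. #0 PeriodicBec (target) — PeriodicBEC, verbatim the shared item
stmt-AtomisticToContinuum-0826 (constant-mode occupation ≥ cN for δ_N-near-minimisers of the
periodic energy on the torus of side (N/ρ)^{1/3}, all small ρ); X_loc ∧ X_prop ⇒ PeriodicBec is pure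
logic (Sketch.lean, target_of_cruxes). (why it might fail: it is the open problem in the
literature's own setting (LSSY2005 Ch. 5 'open after 75 years'); no spectral gap at L=(N/ρ)^{1/3};
hard cores admissible, c uniform in N.) [LiebSeiringerSolovejYngvason2005, Fournais2020, Junge2026,
ChongLiangNam2026]
#2 CoherencePropagation (crux) — X_prop (card crux (C) in robust dress). For every repulsive
finite-range v and every σ > 0 there is ρ₀ > 0 such that for 0 < ρ < ρ₀ there is c > 0 with: for all
large N there is δ > 0 such that every periodic trial state Ψ on the torus of side L = (N/ρ)^{1/3}
with periodicEnergy ≤ E₀^per + δ AND displacement coherence G_Ψ(i,r) ≥ 3/4 for all particles i and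
all |r| ≤ a(ρa³)^{-1/2-σ} (a = scattering length) has condensateOccupation ≥ cN — coherence at any
scale parametrically beyond the healing length propagates to the whole torus UNIFORMLY in N
(stronger than ODLRO at fixed range). Informal mechanism: n₀/N = avg_r G(i,r); beyond the healing
scale the drift mismatch f = Ψ₀/Φ_trial must not be parked in the infrared window |k| < e^{1/2}
(IR-regularity of log f, attached to the Witten Laplacian of the trial measure whose one-particle
spectrum is the phonon branch). [deps: HealingScaleCoherence, PeriodicPhaseRigidity] [difficulty:
open-problem] (why it might fail: an anomalous soft branch below k ~ (excess energy)^{1/2} could let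
G(r) decay slowly beyond a(ρa³)^{-1/2-σ} at no visible energy cost (phase wandering; it does in d=1:
PitaevskiiStringari1991); no theorem excludes it in d=3.) [LiebSeiringerSolovejYngvason2005,
PitaevskiiStringari1991, ReattoChester1967, Junge2026,
Literature.Barriers.AtomisticToContinuum.KineticGapLengthScalesNarrow,
route-AtomisticToContinuum-BECTorusUnfolding]
#4 HealingScaleCoherence (crux) — X_loc (card consequence (A) at the precision of PROVED energy
facts). For every repulsive finite-range v there are σ > 0 and ρ₀ > 0 such that for 0 < ρ < ρ₀, all
large N, some δ > 0 and every δ-near-minimiser Ψ of the periodic energy on the torus of side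
(N/ρ)^{1/3}: G_Ψ(i,r) ≥ 3/4 for every particle i and every |r| ≤ a(ρa³)^{-1/2-σ}. Intended proof:
GroundStateRepresentation with the tree's positive Jastrow state (LSSY2005_jastrowBound_holds, C²
Neumann-type profile so that the parent local energy is non-negative; cf.
BECParentHamiltonian.ParentEnergyProximity with a rate (ρa³)^{2σ}),
LSSY2005_lowerBound_periodic_holds for e ≲ ρaY^{1/17}, transfer along the displacement r by
Cauchy–Schwarz in the trial bridge measure, PeriodicPhaseRigidity to pass to near-minimisers.
Alternative in-class proof: Neumann-cell localisation + LSSY Lemma 4.1/5.2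
(GeneralizedPoincare.lean, EnergyLocalization.lean). [deps: GroundStateRepresentation,
PeriodicPhaseRigidity] [difficulty: L] (why it might fail: the Fisher control is in L²(P_trial) at
the Palm point; moving it to the true law at displaced points needs a-priori pair/three-body
no-clustering bounds for Ψ₀ not in print; hard cores make every KL step infinite (truncate).)
[LiebSeiringerSolovejYngvason2005, OttoVillani2000, AlbeverioHoeghkrohnStreit1977, Fournais2020,
arXiv:2605.06844, route-AtomisticToContinuum-BECParentHamiltonian]
#5 BoundaryTransferWeak (crux) — verbatim the shared item stmt-AtomisticToContinuum-0827 (route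
BECPeriodicReduction): for each repulsive finite-range v, the PeriodicBEC clause for v implies
HasGroundStateBEC v ρ for all small ρ (mode-free Dirichlet criterion). [difficulty: L] (why it might
fail: PeriodicBEC(v) is ground-state-only (δ after N); the Dirichlet ground state lies a wall term ≫
δ above E₀^per and interior restrictions are not periodic, so the hypothesis may never fire; BEC is
BC-sensitive (Robinson1976).) [LiebSeiringerSolovejYngvason2005, Basti2022, BoccatoSeiringer2023,
Junge2026]
#6 PeriodicPhaseRigidity (crux) — verbatim the shared item stmt-AtomisticToContinuum-4205 (route
BECGhostPlasma): L² phase rigidity of torus near-minimisers at fixed N — ∀ v ∃ρ₀ ∀ρ∈(0,ρ₀) ∀ᶠ N,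
E₀^per(N,L) ≠ ⊤ → ∀η>0 ∃δ>0 ∀ Ψ Φ periodic δ-near-minimisers ∃θ: ∫_{cell^N}|Ψ − e^{iθ}Φ|² ≤ η. It is
how every positivity argument (here: the identity for the exact Ψ₀) reaches the near-minimisers the
target quantifies over. [difficulty: M] (why it might fail: hard cores: needs the torus hard-sphere
configuration space {|x_i−x_j|_T > a} to have an energetically dominant connected component for ALL
large N at fixed small ρa³; caged/jammed components degenerate with the dilute one would break it.)
[LiebSeiringerSolovejYngvason2005, doi:10.1093/imrn/rnt012,
route-AtomisticToContinuum-BECGhostPlasma]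
#9 GroundStateRepresentation (support) — the namesake identity, periodic form: for L > 0,
E₀^per(N,L) < ∞, an exact real positive C¹ minimiser Ψ₀ of the periodic energy and any real periodic
trial state Φ, periodicEnergy v Φ = E₀^per + ∫_{cell^N} |∇(Φ/Ψ₀)|² Ψ₀² (= E₀ + ¼ I(P_Φ‖P_Ψ₀)). First
variation of the constrained minimum against the symmetric C¹ direction (Φ/Ψ₀)²Ψ₀, then the Jacobi
identity; no boundary terms on the torus. Vacuous for hard cores (no positive C¹ minimiser), as
intended. [difficulty: provable-now] [LiebSeiringerSolovejYngvason2005,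
AlbeverioHoeghkrohnStreit1977]
#9 LhyScaleCoherence (support) — the card's headline (A): HealingScaleCoherence with the scale
pushed to c'·a(ρa³)^{-3/4} (Junge2026's Neumann-propagation scale, here gap-free and in the
thermodynamic object), from LHY-precision two-sided bounds (FournaisSolovej2020/2022 lower;
YauYin2009, BastiCenatiempoSchlein2021, BastiEtAl2024 upper — to be vendored as named facts; not
load-bearing for the assembly). [difficulty: XL] [FournaisSolovej2020, FournaisSolovej2022,
YauYin2009, BastiCenatiempoSchlein2021, BastiEtAl2024, Junge2026]

TWO-LAYER PLAN. HealingScaleCoherence ⇐ PositiveParentTrialState (positive symmetric periodic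
Jastrow state with C² Neumann-type pair profile: exact
ground state of H − W with the pair part of W ≥ 0 explicit, ⟨W⟩ ≤ CρaY^{σ}N, coherence ≥ 1 −
CY^{1/3}; the quantitative sibling of
BECParentHamiltonian.ParentEnergyProximity) → PalmTransport (a-priori pair-correlation /
no-clustering bound for Ψ₀ turning
I(P_Φ‖P₀), I(P₀‖P_Φ) ≤ 4eN into E_bridge|f∘τ_r − f|² ≤ C|r|²e) → HealingScaleCoherence.
CoherencePropagation ⇐ MismatchInfraredRegularity
(filed informally at open, rank 3: the one-particle H^{-1}-energy of the drift mismatch in the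
window 0 < |k| < e^{1/2} is O(1)
uniformly in N — no single soft phonon sourced by the trial residual (Jastrow Euler–Lagrange / Ward
cancellation), two-phonon sourcing
IR-convergent in d = 3) → CoherenceCriterion (n₀/N = avg_r G, shared support
stmt-AtomisticToContinuum-4438 of BECTorusUnfolding) →
CoherencePropagation.

KILL CRITERIA. ¬CoherencePropagation for some admissible v at arbitrarily small ρ (coherence at the
healing scale WITHOUT macroscopic n₀, i.e. a 3-D
T=0 quasi-condensate) closes the route refuted:CoherencePropagation and, physically, PeriodicBEC
with it. ¬HealingScaleCoherence would
contradict the Neumann-localisation technology (LSSY Thm 5.1 machinery inside the torus) — if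
refuted through a hard-core / E₀ = ⊤
artefact, restate with the finiteness guard; if genuinely, close. ¬BoundaryTransferWeak kills the
Dirichlet end only: pivot to a
Dirichlet version of both cruxes (γ(x,y) ≥ ¾√(ρ(x)ρ(y)); the identity is boundary-condition free).
¬PeriodicPhaseRigidity (hard-core
degeneracy) forces the existential 'SOME positive near-minimiser' typing of the sibling routes in
ranks 2/4. PeriodicBEC proved elsewhere
moots ranks 2 and 4. A proof that for EVERY positive LSSY-accurate trial family the true-law Fisher
information I(P₀‖P_Φ)/N is not o(ρa)
kills the transfer mechanism for rank 4 (fall back to the localisation proof) and the card's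
programme for rank 2.

NOT DECOMPOSED YET. The trial family and the Palm-transport / no-clustering lemma behind rank 4
(layer-2 children above); the Witten-Laplacian spectral
statement behind rank 2 (needs definitions: relative Fisher information, trial bridge measure,
mismatch displacement form — one
definition request filed); hard-core bookkeeping (truncated Jensen, E₀^per < ∞); the Dirichlet
variant; positive temperature; LHY facts
as named Literature defs (only the support item wants them).

CHEAPEST FALSIFIER. Free gas v = 0: a = 0, the coherence hypothesis is vacuous and
CoherencePropagation reduces to free periodic BEC with δ below the gap
(2π/L)² — true; HealingScaleCoherence is trivial (r = 0). Cheapest real test: run the Galilei-boost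
/ phase-modulation family of
KineticGapLengthScalesNarrow (energyWindow_fraction_le, proved) against the exact quantifier order
of both signatures — does a
δ_N-near-minimiser violate G ≥ 3/4 at |r| = a(ρa³)^{-1/2-σ}? By hand: no, the boosts cost 4π²N/L² ≫
δ_N and δ is chosen after N.
Lookup that would downgrade rank 4 to 'known': a printed statement of local ODLRO up to ξY^{-σ} for
the TL ground state (LSSY2005 p. 35
asserts it informally for the GP-box method: "BEC on a length scale ρ^{-1/3}Y^{-1/17}").

NUMBERS. Healing length ξ = (8πρa)^{-1/2} = a(ρa³)^{-1/2}/√(8π); energy precision available as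
THEOREMS in the tree: relative Y^{1/17} below
(LSSY2005 Thm 2.4, C = 64, C' = 1) and a/b ~ Y^{1/3} above (Thm 2.2, Jastrow), so e ≲ ρaY^{1/17} and
the transfer scale e^{-1/2} ≈
ξY^{-1/34} ⇒ any σ < 1/34 in rank 4; LHY precision (ρa³)^{1/2+η}, η = 1/32 at T = 0 (Junge2026
Remark 5) ⇒ scale a(ρa³)^{-3/4-η/2}
(support LhyScaleCoherence; Junge2026 Cor. 6: R ~ a(ρa³)^{-3/4-η}); Fournais2020 Thm 1.2 (PROVED in
tree): full BEC on tori of side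
(ρa)^{-1/2}(ρa³)^{-δ}. Expected truth: G(r) → n₀/N = 1 − (8/3√π)√(ρa³) + …, flat beyond ξ
(Bogoliubov n_k ~ 1/k). Items at open: 8
(4 cruxes of which 2 shared, 1 shared target, 2 support, 1 assembly) + 1 informal crux filed after
open.

DEFINITION REQUESTS. relativeFisherInformation of two (periodic) N-body states, I(P‖Q) = ∫|∇
log(dP/dQ)|² dP = 4∫|∇(Ψ_P/Ψ_Q)|²Ψ_Q² (topic
Literature/MathematicalPhysics/QuantumManyBody; Mathlib has none) — wanted by the informal crux
MismatchInfraredRegularity; the typed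
items inline what they need. Cite facts wanted later (support only): LHY lower bound
(FournaisSolovej2020 Thm 1.1 / FournaisSolovej2022)
and LHY upper bound (YauYin2009; BastiCenatiempoSchlein2021 Thm 1.1; BastiEtAl2024 hard spheres) as
named defs in PeriodicBoseGas.lean.

SUPPORT. Shared in-hub support usable verbatim by provers of ranks 2/4:
BECTorusUnfolding.CoherenceCriterion (stmt-AtomisticToContinuum-4438: a uniform bound s ≤ Re
G_Ψ(i,r) for all i, r gives condensateOccupation ≥ s·N, Fubini on the torus; same coherence
functional and convention as this route) and BECPalmLandscape.OccupationStability
(stmt-AtomisticToContinuum-3300, √occupation is √N-Lipschitz in L²); BoundaryTransferWeak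
(stmt-AtomisticToContinuum-0827) and PeriodicPhaseRigidity (stmt-AtomisticToContinuum-4205) are
attached to this route as shared cruxes (ranks 5, 6).

Novelty: Searches (2026-08-15): lit frontier AtomisticToContinuum --since 2020 (30 rows; Bose-gas descendants
arXiv:2603.20776, arXiv:2510.20493,
arXiv:2602.16566, arXiv:2605.06844 — the last read pp. 1–3: LHY upper bounds are Fock-space
constructions, no positive first-quantised
state); lit bridges AtomisticToContinuum --cross any (30 rows, no Bose-gas bridge beyond Rougerie's
notes arXiv:2002.02678); lit search
--hybrid "relative Fisher information ground state" (10 book hits, information-theory/QM textbooks,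
none many-body); lit vsearch ×2
(ground-state representation → LSSY2005 pp. 13, 17; local ODLRO propagation →
Griffin1995/LSSY2005/Griffin1993 textbook pages only); lit
search --source crossref "ground state representation Bose gas condensation density matrix" (20
rows: LiebYngvason1998, ErdosSchleinYau2008,
NamNapiorkowski2021 — energy or mean-field only); lit galaxy search --star all "relative Fisher
information ground state" → galaxyd queue
saturated (> 90 s), OpenAlex/S2/arXiv HTTP 429 in this pass (recorded); the card's audit-13 searches
(zbMATH, crossref) found nothing
connecting the identity to ODLRO transfer; sibling route files read (BECTorusUnfolding,
BECParentHamiltonian, BECGhostPlasma,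
BECPalmLandscape, BECSwapAffinity, BECConditionalEntropy).
Nearest prior art found: LiebSeiringerSolovejYngvason2005 Thm 5.1 / Lemma 5.2 and Fournais2020 Thm
1.2 (both PROVED in the tree) and
Junge2026 (arXiv:2603.20776) Cor. 6 — condensation on sub-thermodynamic boxes by energy loca  [refs: 10.1006/jfan.1999.3557, 2603.20776, 2510.20493, 2602.16566, 2605.06844, 2002.02678, doi:10.1006/jfan.1999.3557, LSSY2005, Griffin1993, LiebYngvason1998, ErdosSchleinYau2008, LiebSeiringerSolovejYngvason2005, Fournais2020, Junge2026, OttoVillani2000, AlbeverioHoeghkrohnStreit1977]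

Barriers (technique_class: relative-fisher-info positive-ground-state propagation): - technique_class: relative-fisher-info positive-ground-state propagation
- Literature.Barriers.AtomisticToContinuum.KineticGapLengthScalesNarrow: its proved obstruction
(Galilei boosts: an energy WINDOW valid for all states certifies nothing beyond ρaL²ε ≲ 1) is met by
quantifier order and by mechanism — δ is chosen after N (below the N-body gap), and the transfer
uses the two exits the entry names, (a) the eigenvalue equation beyond the value E₀ (the identity
needs HΨ₀ = E₀Ψ₀) and (b) positivity Ψ₀ > 0 (affinity form of γ); rank 4 deliberately stays at the
sub-thermodynamic scale the entry allows, rank 2 is where the entry bites and is filed as the open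
heart.
- Literature.Barriers.AtomisticToContinuum.KineticGapLengthScales: applies to any proof of rank 2 by
localisation + gap (stops at a(ρa³)^{-3/4-η}); evaded only insofar as MismatchInfraredRegularity
replaces the free gap (2π/L)² by the phonon branch of the trial measure's Witten Laplacian — the
bet, no tool in hand.
- Literature.Barriers.AtomisticToContinuum.EnergyAsymptoticsWithoutCondensationNarrow: the route is
the entry's own exception class — a d = 3-specific inference (IR window Σ_{|k|<√e} k^{-2}|δb̂(k)|²,
summable in d = 3 only) from energy PLUS the eigen-equation and positivity, never from the value of
e₀(ρ) alone; in the Lieb–Liniger witness the identity still holds but the trial landscape difference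
itself grows like log|x−y|, so nothing false is inferred in d = 1.
- Literature.Barriers.AtomisticToContinuum.E

History (route lifecycle, newest last):
- 2026-08-15T13:40:05Z · CLOSED retired — not-a-thesis: assembly does not conclude the sub-problem Statement (operator:999:1257524)

sub-problem: BoseEinsteinCondensation · status: closed(retired) · opened planner-plancard-AtomisticToContinuum-BoseEin-821147fd-0 2026-08-15T11:44:47Z · rev 1 · ledger route-AtomisticToContinuum-BECRelativeFisher
GENERATED by the gate from the ledger (D-0016/17). Provers cite these decls: `theorem foo : Summit.AtomisticToContinuum.BoseEinsteinCondensation.Theses.BECRelativeFisher.<Decl> := …` in Summits/AtomisticToContinuum/BoseEinsteinCondensation/Theorems/<Name>.lean.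
-/

namespace Summit.AtomisticToContinuum.BoseEinsteinCondensation.Theses.BECRelativeFisher

open scoped BigOperators Topology Manifold Classical MeasureTheory ProbabilityTheory Matrix InnerProductSpace ComplexConjugate ContinuousMap
open Filter Set Function TopologicalSpace MeasureTheory

attribute [summit_statement] _root_.BoseEinsteinCondensation

/-- item stmt-AtomisticToContinuum-0826 · target · rank 0 · closed · moot by None · by planner
why it might fail: it is the open problem in the literature's own setting (LSSY2005 Ch. 5 'open after 75 years'); no spectral gap at L=(N/ρ)^{1/3}; hard cores admissible, c uniform in N.
sources: LiebSeiringerSolovejYngvason2005, Fournais2020, Junge2026, ChongLiangNam2026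
[crux] PeriodicBEC: for every repulsive finite-range radial v there is ρ₀>0 such that for 0<ρ<ρ₀
there is c>0 with: for all large N there is δ>0 such that every PERIODIC trial state Ψ on the torus
of side L=(N/ρ)^{1/3} with periodicEnergy ≤ E₀^per(N,L)+δ has constant-mode occupation ⟨Ψ,n₀Ψ⟩ =
condensateOccupation N L Ψ ≥ cN. The open problem in the literature's own (translation-invariant)
setting; Fournais2020 Thm 1.2 gives it on scales L ≤ C(ρa³)^{-δ}(ρa)^{-1/2}, Junge2026 Cor. 6
(Neumann) up to a(ρa³)^{-3/4-η}. Sources: LiebSeiringerSolovejYngvason2005 Ch. 5; Fournais2020;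
Junge2026; ChongLiangNam2026. -/
@[route_item "route-AtomisticToContinuum-BECRelativeFisher"]
def PeriodicBec : Prop :=
  ∀ v : ℝ → ENNReal, Literature.MathematicalPhysics.QuantumManyBody.BoseGas.IsRepulsiveFiniteRange v → ∃ ρ₀ : ℝ, 0 < ρ₀ ∧ ∀ ρ : ℝ, 0 < ρ → ρ < ρ₀ → ∃ c : ℝ, 0 < c ∧ ∀ᶠ N : ℕ in Filter.atTop, ∃ δ : ENNReal, 0 < δ ∧ ∀ Ψ : Literature.MathematicalPhysics.QuantumManyBody.BoseGas.PeriodicTrialState N (Literature.MathematicalPhysics.QuantumManyBody.BoseGas.sideLength ρ N), Literature.MathematicalPhysics.QuantumManyBody.BoseGas.periodicEnergy v Ψ ≤ Literature.MathematicalPhysics.QuantumManyBody.BoseGas.periodicGroundStateEnergy v N (Literature.MathematicalPhysics.QuantumManyBody.BoseGas.sideLength ρ N) + δ → ENNReal.ofReal (c * N) ≤ Literature.MathematicalPhysics.QuantumManyBody.BoseGas.condensateOccupation N (Literature.MathematicalPhysics.QuantumManyBody.BoseGas.sideLength ρ N) Ψ.ψ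

/-- item stmt-AtomisticToContinuum-6144 · crux · rank 2 · closed · moot by None · by planner
why it might fail: an anomalous soft branch below k ~ (excess energy)^{1/2} could let G(r) decay slowly beyond a(ρa³)^{-1/2-σ} at no visible energy cost (phase wandering; it does in d=1: PitaevskiiStringari1991); no theorem excludes it in d=3.
sources: LiebSeiringerSolovejYngvason2005, PitaevskiiStringari1991, ReattoChester1967, Junge2026, Literature.Barriers.AtomisticToContinuum.KineticGapLengthScalesNarrow, route-AtomisticToContinuum-BECTorusUnfolding
[crux] X_prop (card crux (C) in robust dress). For every repulsive finite-range v and every σ > 0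
there is ρ₀ > 0 such that for 0 < ρ < ρ₀ there is c > 0 with: for all large N there is δ > 0 such
that every periodic trial state Ψ on the torus of side L = (N/ρ)^{1/3} with periodicEnergy ≤ E₀^per
+ δ AND displacement coherence G_Ψ(i,r) ≥ 3/4 for all particles i and all |r| ≤ a(ρa³)^{-1/2-σ} (a =
scattering length) has condensateOccupation ≥ cN — coherence at any scale parametrically beyond the
healing length propagates to the whole torus UNIFORMLY in N (stronger than ODLRO at fixed range).
Informal mechanism: n₀/N = avg_r G(i,r); beyond the healing scale the drift mismatch f = Ψ₀/Φ_trial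
must not be parked in the infrared window |k| < e^{1/2} (IR-regularity of log f, attached to the
Witten Laplacian of the trial measure whose one-particle spectrum is the phonon branch). [deps:
HealingScaleCoherence, PeriodicPhaseRigidity] [difficulty: open-problem] -/
@[route_item "route-AtomisticToContinuum-BECRelativeFisher"]
def CoherencePropagation : Prop :=
  ∀ v : ℝ → ENNReal, Literature.MathematicalPhysics.QuantumManyBody.BoseGas.IsRepulsiveFiniteRange v → ∀ σ : ℝ, 0 < σ → ∃ ρ₀ : ℝ, 0 < ρ₀ ∧ ∀ ρ : ℝ, 0 < ρ → ρ < ρ₀ → ∃ c : ℝ, 0 < c ∧ ∀ᶠ N : ℕ in Filter.atTop, ∃ δ : ENNReal, 0 < δ ∧ ∀ Ψ : Literature.MathematicalPhysics.QuantumManyBody.BoseGas.PeriodicTrialState N (Literature.MathematicalPhysics.QuantumManyBody.BoseGas.sideLength ρ N), Literature.MathematicalPhysics.QuantumManyBody.BoseGas.periodicEnergy v Ψ ≤ Literature.MathematicalPhysics.QuantumManyBody.BoseGas.periodicGroundStateEnergy v N (Literature.MathematicalPhysics.QuantumManyBody.BoseGas.sideLength ρ N) + δ → (∀ (i : Fin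 N) (r : EuclideanSpace ℝ (Fin 3)), ‖r‖ ≤ (Literature.MathematicalPhysics.QuantumManyBody.BoseGas.scatteringLength v).toReal * (ρ * (Literature.MathematicalPhysics.QuantumManyBody.BoseGas.scatteringLength v).toReal ^ 3) ^ (-(1 : ℝ) / 2 - σ) → (3 / 4 : ℝ) ≤ (∫ X in Literature.MathematicalPhysics.QuantumManyBody.BoseGas.cellN N (Literature.MathematicalPhysics.QuantumManyBody.BoseGas.sideLength ρ N), conj (Ψ.ψ (Function.update X i (X i + r))) * Ψ.ψ X).re) → ENNReal.ofReal (c * N) ≤ Literature.MathematicalPhysics.QuantumManyBody.BoseGas.condensateOccupation N (Literature.MathematicalPhysics.QuantumManyBody.BoseGas.sideLength ρ N) Ψ.ψ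

-- item stmt-AtomisticToContinuum-7022 · crux · rank 3 · closed · moot by None · by planner — informal only, no Lean statement yet:
--   [crux] MismatchInfraredRegularity (card crux (C); rank 3; to be typed once the notions land).
--   Setting: torus of side L=(N/ρ)^{1/3}; Φ>0 the positive symmetric periodic Jastrow(-phonon) trial
--   state behind HealingScaleCoherence; Ψ₀ the positive periodic ground state; f := Ψ₀/Φ; e :=
--   (E(Φ)−E₀)/N the excess energy per particle, so E_{P_Φ}|∇₁ log f|² = e by GroundStateRepresentation
--   (energy excess = ¼ relative Fisher information). CLAIM: there is C independent of N such that for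
--   all small ρ and all large N the one-particle drift mismatch δb := ∇₁ log f has bounded H^{-1}-energy
--   in the far-infrared

/-- item stmt-AtomisticToContinuum-6145 · crux · rank 4 · closed · moot by None · by planner
why it might fail: the Fisher control is in L²(P_trial) at the Palm point; moving it to the true law at displaced points needs a-priori pair/three-body no-clustering bounds for Ψ₀ not in print; hard cores make every KL step infinite (truncate).
sources: LiebSeiringerSolovejYngvason2005, OttoVillani2000, AlbeverioHoeghkrohnStreit1977, Fournais2020, arXiv:2605.06844, route-AtomisticToContinuum-BECParentHamiltonian
[crux] X_loc (card consequence (A) at the precision of PROVED energy facts). For every repulsive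
finite-range v there are σ > 0 and ρ₀ > 0 such that for 0 < ρ < ρ₀, all large N, some δ > 0 and
every δ-near-minimiser Ψ of the periodic energy on the torus of side (N/ρ)^{1/3}: G_Ψ(i,r) ≥ 3/4 for
every particle i and every |r| ≤ a(ρa³)^{-1/2-σ}. Intended proof: GroundStateRepresentation with the
tree's positive Jastrow state (LSSY2005_jastrowBound_holds, C² Neumann-type profile so that the
parent local energy is non-negative; cf. BECParentHamiltonian.ParentEnergyProximity with a rate
(ρa³)^{2σ}), LSSY2005_lowerBound_periodic_holds for e ≲ ρaY^{1/17}, transfer along the displacement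
r by Cauchy–Schwarz in the trial bridge measure, PeriodicPhaseRigidity to pass to near-minimisers.
Alternative in-class proof: Neumann-cell localisation + LSSY Lemma 4.1/5.2
(GeneralizedPoincare.lean, EnergyLocalization.lean). [deps: GroundStateRepresentation,
PeriodicPhaseRigidity] [difficulty: L] -/
@[route_item "route-AtomisticToContinuum-BECRelativeFisher"]
def HealingScaleCoherence : Prop :=
  ∀ v : ℝ → ENNReal, Literature.MathematicalPhysics.QuantumManyBody.BoseGas.IsRepulsiveFiniteRange v → ∃ σ : ℝ, 0 < σ ∧ ∃ ρ₀ : ℝ, 0 < ρ₀ ∧ ∀ ρ : ℝ, 0 < ρ → ρ < ρ₀ → ∀ᶠ N : ℕ in Filter.atTop, ∃ δ : ENNReal, 0 < δ ∧ ∀ Ψ : Literature.MathematicalPhysics.QuantumManyBody.BoseGas.PeriodicTrialState N (Literature.MathematicalPhysics.QuantumManyBody.BoseGas.sideLength ρ N), Literature.MathematicalPhysics.QuantumManyBody.BoseGas.periodicEnergy v Ψ ≤ Literature.MathematicalPhysics.QuantumManyBody.BoseGas.periodicGroundStateEnergy v N (Literature.MathematicalPhysics.QuantumManyBody.BoseGas.sideLength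 ρ N) + δ → ∀ (i : Fin N) (r : EuclideanSpace ℝ (Fin 3)), ‖r‖ ≤ (Literature.MathematicalPhysics.QuantumManyBody.BoseGas.scatteringLength v).toReal * (ρ * (Literature.MathematicalPhysics.QuantumManyBody.BoseGas.scatteringLength v).toReal ^ 3) ^ (-(1 : ℝ) / 2 - σ) → (3 / 4 : ℝ) ≤ (∫ X in Literature.MathematicalPhysics.QuantumManyBody.BoseGas.cellN N (Literature.MathematicalPhysics.QuantumManyBody.BoseGas.sideLength ρ N), conj (Ψ.ψ (Function.update X i (X i + r))) * Ψ.ψ X).re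

/-- item stmt-AtomisticToContinuum-0827 · crux · rank 5 · open · by planner
why it might fail: PeriodicBEC(v) is ground-state-only (δ after N); the Dirichlet ground state lies a wall term ≫ δ above E₀^per and interior restrictions are not periodic, so the hypothesis may never fire without a structural Neumann-bracketing argument; BEC is BC-sensitive (Robinson1976).
sources: LiebSeiringerSolovejYngvason2005, Basti2022, BoccatoSeiringer2023, Junge2026, doi:10.1007/bf01608554
[crux] BoundaryTransferWeak (mode-free boundary-condition transfer, per potential): for each
repulsive finite-range v, PeriodicBEC(v) implies ∃ρ₀>0 ∀ρ∈(0,ρ₀) HasGroundStateBEC v ρ (Dirichlet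
ground state, λ_max(γ) ≥ cN via condensateNumber). Not glue: near-minimiser slacks are O(N/L²) while
Dirichlet/periodic energies differ by a boundary term ≫ N/L², so no energy-comparison proof;
expected route: Neumann bracketing of interior sub-boxes (−Δ_Dir ≥ ⊕−Δ_Neu, v ≥ 0) + a mode-free
criterion (λ_max ≥ tr γ²/N). Only the ENERGY analogue is in print (LiebSeiringerSolovejYngvason2005
Ch. 2 after (2.8)). v ≡ 0: hypothesis and conclusion both true. -/
@[route_item "route-AtomisticToContinuum-BECRelativeFisher"]
def BoundaryTransferWeak : Prop :=
  ∀ v : ℝ → ENNReal, Literature.MathematicalPhysics.QuantumManyBody.BoseGas.IsRepulsiveFiniteRange v → (∃ ρ₀ : ℝ, 0 < ρ₀ ∧ ∀ ρ : ℝ, 0 < ρ → ρ < ρ₀ → ∃ c : ℝ, 0 < c ∧ ∀ᶠ N : ℕ in Filter.atTop, ∃ δ : ENNReal, 0 < δ ∧ ∀ Ψ : Literature.MathematicalPhysics.QuantumManyBody.BoseGas.PeriodicTrialState N (Literature.MathematicalPhysics.QuantumManyBody.BoseGas.sideLength ρ N), Literature.MathematicalPhysics.QuantumManyBody.BoseGas.periodicEnergy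 v Ψ ≤ Literature.MathematicalPhysics.QuantumManyBody.BoseGas.periodicGroundStateEnergy v N (Literature.MathematicalPhysics.QuantumManyBody.BoseGas.sideLength ρ N) + δ → ENNReal.ofReal (c * N) ≤ Literature.MathematicalPhysics.QuantumManyBody.BoseGas.condensateOccupation N (Literature.MathematicalPhysics.QuantumManyBody.BoseGas.sideLength ρ N) Ψ.ψ) → ∃ ρ₀ : ℝ, 0 < ρ₀ ∧ ∀ ρ : ℝ, 0 < ρ → ρ < ρ₀ → Literature.MathematicalPhysics.QuantumManyBody.BoseGas.HasGroundStateBEC v ρ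

/-- item stmt-AtomisticToContinuum-4205 · crux · rank 6 · closed · moot by None · by planner
why it might fail: hard cores: needs the torus hard-sphere configuration space {|x_i−x_j|_T > a} to have an energetically dominant connected component for ALL large N at fixed small ρa³; caged/jammed components degenerate with the dilute one would break it.
sources: LiebSeiringerSolovejYngvason2005, doi:10.1093/imrn/rnt012, route-AtomisticToContinuum-BECGhostPlasma
[crux] L² phase rigidity of torus near-minimisers at fixed N (the needle-proofing of every pointwise
statement): ∀ v ∃ρ₀ ∀ρ∈(0,ρ₀) ∀ᶠ N, E₀^per(N,L) ≠ ⊤ → ∀η>0 ∃δ>0 ∀ Ψ Φ periodic δ-near-minimisers ∃θ: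
∫_{cellN} |Ψ − e^(iθ)Φ|² ≤ η. Content: uniqueness of the periodic ground state up to phase
(Perron–Frobenius / positivity-improving semigroup; hard cores: connectedness of the hard-sphere
configuration space on the torus) + compact resolvent (gap at fixed N, L; δ ≤ η·gap). v ≡ 0: true
(gap (2π/L)²). [difficulty: M] -/
@[route_item "route-AtomisticToContinuum-BECRelativeFisher"]
def PeriodicPhaseRigidity : Prop :=
  ∀ v : ℝ → ENNReal, Literature.MathematicalPhysics.QuantumManyBody.BoseGas.IsRepulsiveFiniteRange v → ∃ ρ₀ : ℝ, 0 < ρ₀ ∧ ∀ ρ : ℝ, 0 < ρ → ρ < ρ₀ → ∀ᶠ N : ℕ in Filter.atTop, Literature.MathematicalPhysics.QuantumManyBody.BoseGas.periodicGroundStateEnergy v N (Literature.MathematicalPhysics.QuantumManyBody.BoseGas.sideLength ρ N) ≠ ⊤ → ∀ η : ℝ, 0 < η → ∃ δ : ENNReal, 0 < δ ∧ ∀ Ψ Φ : Literature.MathematicalPhysics.QuantumManyBody.BoseGas.PeriodicTrialState N (Literature.MathematicalPhysics.QuantumManyBody.BoseGas.sideLength ρ N), Literature.MathematicalPhysics.QuantumManyBody.BoseGas.periodicEnergy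 v Ψ ≤ Literature.MathematicalPhysics.QuantumManyBody.BoseGas.periodicGroundStateEnergy v N (Literature.MathematicalPhysics.QuantumManyBody.BoseGas.sideLength ρ N) + δ → Literature.MathematicalPhysics.QuantumManyBody.BoseGas.periodicEnergy v Φ ≤ Literature.MathematicalPhysics.QuantumManyBody.BoseGas.periodicGroundStateEnergy v N (Literature.MathematicalPhysics.QuantumManyBody.BoseGas.sideLength ρ N) + δ → ∃ θ : ℝ, (∫⁻ X in Literature.MathematicalPhysics.QuantumManyBody.BoseGas.cellN N (Literature.MathematicalPhysics.QuantumManyBody.BoseGas.sideLength ρ N), (‖Ψ.ψ X - Complex.exp (↑θ * Complex.I) * Φ.ψ X‖₊ : ENNReal) ^ 2) ≤ ENNReal.ofReal η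

/-- item stmt-AtomisticToContinuum-6146 · support · rank 9 · closed · moot by None · by planner
sources: LiebSeiringerSolovejYngvason2005, AlbeverioHoeghkrohnStreit1977
[support] the namesake identity, periodic form: for L > 0, E₀^per(N,L) < ∞, an exact real positive
C¹ minimiser Ψ₀ of the periodic energy and any real periodic trial state Φ, periodicEnergy v Φ =
E₀^per + ∫_{cell^N} |∇(Φ/Ψ₀)|² Ψ₀² (= E₀ + ¼ I(P_Φ‖P_Ψ₀)). First variation of the constrained
minimum against the symmetric C¹ direction (Φ/Ψ₀)²Ψ₀, then the Jacobi identity; no boundary terms on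
the torus. Vacuous for hard cores (no positive C¹ minimiser), as intended. [difficulty:
provable-now] -/
@[route_item "route-AtomisticToContinuum-BECRelativeFisher"]
def GroundStateRepresentation : Prop :=
  ∀ (v : ℝ → ENNReal) (N : ℕ) (L : ℝ), 0 < L → Literature.MathematicalPhysics.QuantumManyBody.BoseGas.periodicGroundStateEnergy v N L ≠ ⊤ → ∀ Ψ₀ Φ : Literature.MathematicalPhysics.QuantumManyBody.BoseGas.PeriodicTrialState N L, (∀ X, Ψ₀.ψ X = ((Ψ₀.ψ X).re : ℂ) ∧ 0 < (Ψ₀.ψ X).re) → (∀ X, Φ.ψ X = ((Φ.ψ X).re : ℂ)) → Literature.MathematicalPhysics.QuantumManyBody.BoseGas.periodicEnergy v Ψ₀ = Literature.MathematicalPhysics.QuantumManyBody.BoseGas.periodicGroundStateEnergy v N L → Literature.MathematicalPhysics.QuantumManyBody.BoseGas.periodicEnergy v Φ = Literature.MathematicalPhysics.QuantumManyBody.BoseGas.periodicGroundStateEnergy v N L + ∫⁻ X in Literature.MathematicalPhysics.QuantumManyBody.BoseGas.cellN N L, (∑ i : Fin N, ∑ k : Fin 3, (‖fderiv ℝ (fun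 Y => (Φ.ψ Y).re / (Ψ₀.ψ Y).re) X (Pi.single i (EuclideanSpace.single k (1 : ℝ)))‖₊ : ENNReal) ^ 2) * ENNReal.ofReal ((Ψ₀.ψ X).re ^ 2)

/-- item stmt-AtomisticToContinuum-6147 · support · rank 9 · closed · moot by None · by planner
sources: FournaisSolovej2020, FournaisSolovej2022, YauYin2009, BastiCenatiempoSchlein2021, BastiEtAl2024, Junge2026
[support] the card's headline (A): HealingScaleCoherence with the scale pushed to c'·a(ρa³)^{-3/4}
(Junge2026's Neumann-propagation scale, here gap-free and in the thermodynamic object), from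
LHY-precision two-sided bounds (FournaisSolovej2020/2022 lower; YauYin2009,
BastiCenatiempoSchlein2021, BastiEtAl2024 upper — to be vendored as named facts; not load-bearing
for the assembly). [difficulty: XL] -/
@[route_item "route-AtomisticToContinuum-BECRelativeFisher"]
def LhyScaleCoherence : Prop :=
  ∀ v : ℝ → ENNReal, Literature.MathematicalPhysics.QuantumManyBody.BoseGas.IsRepulsiveFiniteRange v → ∃ c' : ℝ, 0 < c' ∧ ∃ ρ₀ : ℝ, 0 < ρ₀ ∧ ∀ ρ : ℝ, 0 < ρ → ρ < ρ₀ → ∀ᶠ N : ℕ in Filter.atTop, ∃ δ : ENNReal, 0 < δ ∧ ∀ Ψ : Literature.MathematicalPhysics.QuantumManyBody.BoseGas.PeriodicTrialState N (Literature.MathematicalPhysics.QuantumManyBody.BoseGas.sideLength ρ N), Literature.MathematicalPhysics.QuantumManyBody.BoseGas.periodicEnergy v Ψ ≤ Literature.MathematicalPhysics.QuantumManyBody.BoseGas.periodicGroundStateEnergy v N (Literature.MathematicalPhysics.QuantumManyBody.BoseGas.sideLength ρ N) + δ → ∀ (i : Fin N) (r : EuclideanSpace ℝ (Fin 3)), ‖r‖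 ≤ c' * (Literature.MathematicalPhysics.QuantumManyBody.BoseGas.scatteringLength v).toReal * (ρ * (Literature.MathematicalPhysics.QuantumManyBody.BoseGas.scatteringLength v).toReal ^ 3) ^ (-(3 : ℝ) / 4) → (3 / 4 : ℝ) ≤ (∫ X in Literature.MathematicalPhysics.QuantumManyBody.BoseGas.cellN N (Literature.MathematicalPhysics.QuantumManyBody.BoseGas.sideLength ρ N), conj (Ψ.ψ (Function.update X i (X i + r))) * Ψ.ψ X).re

/-- item stmt-AtomisticToContinuum-6148 · assembly · rank 1 · closed · moot by None · by planner
sources: LiebSeiringerSolovejYngvason2005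
[assembly] HealingScaleCoherence → CoherencePropagation → BoundaryTransferWeak →
BoseEinsteinCondensation. -/
@[route_item "route-AtomisticToContinuum-BECRelativeFisher"]
def Assembly : Prop :=
  HealingScaleCoherence → CoherencePropagation → BoundaryTransferWeak → Literature.MathematicalPhysics.QuantumManyBody.BoseGas.BoseEinsteinCondensation

end Summit.AtomisticToContinuum.BoseEinsteinCondensation.Theses.BECRelativeFisher
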